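import Literature.MathematicalPhysics.QuantumFieldTheory.Balaban1983to89.B5CombesThomasLattice

/-!
# `Balaban1983to89.B5CombesThomasLatticeSolve` — the «simplest proof» route of B5 p. 36 FOR `G = Δ_a⁻¹` on the lattice torus
# of record, part 2: the conjugated `∂P∂*` under the printed kernel bound (1.126), COERCIVITY of `e^{δρ}Δ_a e^{−δρ}` from
# (1.90), and the WEIGHTED SOLVES `Σ‖∇(e^{δρ}Gf)‖² + ‖e^{δρ}Gf‖² ≤ C‖f‖²`

statement-level skeleton of published theorems with citation tags; proofs where landed; nothing here is a claim
about the Yang–Mills mass gap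

Source (lit-balaban cell, Phase-2 proof seat p37 gen 7): T. Bałaban, *Propagators and renormalization transformations
for lattice gauge theories. I*, Commun. Math. Phys. **95** (1984) 17–40 [`Balaban1984PropagatorsI`, "B5"], pp. 33, 36–39
[PDF 17, 20–23]; held as `paper:balaban1984-cmp95-propagators-rt-i`.  Unit `lit-balaban-p37`, HOME
`run/shared/lean/pub/lit-balaban/` (SKELETON row B5.Prop1.2, owner's census item (vi)-G).  Continuation of
`B5CombesThomasLattice` (weights, conjugated Laplacian and averaging operator); see its header for the printed text in full.

## WHAT IS PRINTED (verbatim, the inputs of this part)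

p. 36 [PDF 20]: «… proving that the operator e^{−⟨q,x⟩}Δ_a e^{⟨q,x⟩} − Δ_a is a small perturbation of Δ_a for vectors
q ∈ R^d sufficiently small.»
p. 33 [PDF 17], Prop. 1.1: «This implies the bound from below: Δ_a = G⁻¹ ≥ γ₀(Δ + I). (1.90)»
p. 37 [PDF 21], (1.120): «(∂P∂*hA)_μ(x) = Σ_{x′,ν} η^d(∂P∂*)_{μν}(x, x′)h(x′)A_ν(x′)».
p. 38 [PDF 22], (1.126): «|(∂P∂*)_{μ,ν}(x, x′)| ≤ O(1)e^{−δ′₀|x−x′|}, (1.126) … The constant O(1) in (1.126) depends on d only».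

## WHAT THIS MODULE PROVES (kernel-checked, zero sorry)

* §7 `dPd n M := GradOp·PcT·GradOpᴴ` (so that `DeltaA = Lap − dPd + a•QvAdj·QvOp` definitionally, `DeltaA_eq`); UNDER THE
  HYPOTHESIS `h126 : ∀ i j, ‖dPd n M i j‖ ≤ C·η^d·e^{−δ′|x_i−x_j|}` ((1.126) read on the matrix of record with the
  convention (1.120): the matrix entry is `η^d` times the printed kernel): row/column sums `≤ normK = C·d·e^{2δ′}K_d(δ′)`
  (`dPd_rowsum_le`, Schur ⇒ `dPd_form_le`, `nsq_dPd_mulVec_le`: «∂P∂*» is bounded on L²(T_η) uniformly in η and the torus),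
  and the conjugation perturbation `|⟨Ew, ∂P∂*(E⁻¹w)⟩ − ⟨w, ∂P∂*w⟩| ≤ |δ|·cK·‖w‖²` for `|δ| ≤ δ′/2` (`conjDPD_sub_le`, Schur
  with `e^{δs} − 1 ≤ δse^{δs}` and `se^{−(δ′/4)s} ≤ 4/δ′`);
* §8 COERCIVITY OF THE CONJUGATED FORM (the «small perturbation of Δ_a»): with `γ₀ = gammaZero d a` of r02's (1.90)
  `B5Prop11Lattice.ineq190_form`, for `w = Ev`, `0 ≤ δ ≤ min(1, δ′/2)`:
  `(γ₀ − δ·Theta)·(Σ_ν‖∇_νw‖² + ‖w‖²) ≤ Re⟨Ew, Δ_a v⟩` (`conj_coercive`), `Theta = 2d + 4e⁴a + cK`; the admissible exponent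
  `delta1 = min(1, δ′/2, γ₀/(2Θ))` at which the constant is `≥ γ₀/2` (`delta1_spec`);
* §9 THE WEIGHTED SOLVES: for a source `f` supported on the bonds over `Δ̃(y₁)` and `Δ_a v = f`, `w = e^{δρ_{y₁}}v`,
  `0 ≤ δ ≤ δ₁`: `Σ_ν‖∇_νw‖² + ‖w‖² ≤ (2e^δ/γ₀)²‖f‖²` (`solve_bound`); for a divergence source `f = Σ_ν ∇_ν^*T_ν` with the
  `T_ν` supported over `Δ̃(y₁)`: `≤ 72(d+1)e^{2δ}/γ₀²·Σ_ν‖T_ν‖²` (`solveDiv_bound`); the product rule `norm_fdiff_wmul_le`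
  and the dictionary on the cubes (`wt_neg_le_of_mem_cubeT`: `e^{−δρ_{y₁}} ≤ e^{2δ}e^{−δ|y−y₁|}` on `Δ̃(y)`, `wt_le_of_mem_cubeT`);
* §10 `‖E∂P∂*E⁻¹w‖ ≤ (normK + |δ|cK)‖w‖`, `‖EQ*QE⁻¹w‖ ≤ e^{4|δ|}‖w‖` (for the second-order entry of (1.114)).

## HONEST SCOPE / DIVERGENCE

As in part 1: this is the alternative route named on p. 36 for `Δ_a`, run on the torus — a DIVERGENCE OF METHOD from the
printed random walk (1.118)–(1.131), disclosed; the statement served, (1.114) for G (`B5.Local114Fam`), is unchanged.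
(1.126) enters ONLY as the hypothesis `h126` in printed form on the matrix of record; its discharge from
`B5DPD126Uniform.matrixP_decay_uniform` needs the identification of `PcT` with the multiplier-model projection (r02's
(1.132) memo), not done here.  Constants ours and explicit.  CELL BOOK-KEEPING (lit-balaban): row B5.Prop1.2, census item
(vi)-G (owner r02, referee ref-4); VALUE = the L² decay mechanism for G = Δ_a⁻¹ on the torus modulo the printed leaf
(1.126), kernel-checked — NOT summit progress.
-/

namespace Literature.MathematicalPhysics.QuantumFieldTheory.Balaban1983to89.B5CombesThomasLatticeSolve

open scoped BigOperators Matrix ComplexConjugate ComplexOrder Matrix.Norms.L2Operator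
open Finset Complex Matrix
open Literature.MathematicalPhysics.QuantumFieldTheory.Balaban1983to89.B5Prop11Plancherel (Tor fine fdiff shiftM unitVec)
open Literature.MathematicalPhysics.QuantumFieldTheory.Balaban1983to89.B5Prop11Lower (Lap nsq nsq_nonneg
  star_dotProduct_self form_gram)
open Literature.MathematicalPhysics.QuantumFieldTheory.Balaban1983to89.B5Prop11Lattice (gammaZero gammaZero_pos
  ineq190_form)
open Literature.MathematicalPhysics.QuantumFieldTheory.Balaban1983to89.B5Prop11G0Torus (form_Lap qent QvOp_eq_qent
  qent_rowsum qent_colsum)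
open Literature.MathematicalPhysics.QuantumFieldTheory.Balaban1983to89.B5Prop12FieldsLattice (cdistF distU distSite
  toFine cube1 cubeT distU_nonneg distSite_nonneg toFine_mem_cubeT)
open Literature.MathematicalPhysics.QuantumFieldTheory.Balaban1983to89.B5DeltaA169 (DeltaA QvAdj)
open Literature.MathematicalPhysics.QuantumFieldTheory.Balaban1983to89.B5Block118 (QvOp bpt tstep)
open Literature.MathematicalPhysics.QuantumFieldTheory.Balaban1983to89.B5Value126 (PcT)
open Literature.MathematicalPhysics.QuantumFieldTheory.Balaban1983to89.B5Action121 (GradOp)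
open Literature.MathematicalPhysics.QuantumFieldTheory.Balaban1983to89.B5RowSumsP12Lattice (rowSum_univ_distSite_le
  distSite_comm distSite_triangle)
open Literature.MathematicalPhysics.QuantumFieldTheory.Balaban1983to89.B4Sect5Proof (latticeConst latticeConst_nonneg)
open Literature.MathematicalPhysics.QuantumFieldTheory.Balaban1983to89.B5CoverP12Lattice (distU_comm)
open Literature.MathematicalPhysics.QuantumFieldTheory.Balaban1983to89.B5CombesThomasLattice

noncomputable section

variable {d : ℕ}

/-! ## §6′ Elementary real-analysis steps (private) -/

/-- `e^s − 1 ≤ s·e^s` (convexity: `1 − s ≤ e^{−s}`). [folklore] -/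
private theorem exp_sub_one_le_mul_exp (s : ℝ) : Real.exp s - 1 ≤ s * Real.exp s := by
  have := Real.add_one_le_exp (-s)
  have hpos := Real.exp_pos s
  have hprod : Real.exp s * Real.exp (-s) = 1 := by rw [← Real.exp_add, add_neg_cancel, Real.exp_zero]
  nlinarith

/-- `s·e^{−cs} ≤ 1/c` for `c > 0`. [folklore] -/
private theorem mul_exp_neg_le {c : ℝ} (hc : 0 < c) (s : ℝ) : s * Real.exp (-(c * s)) ≤ 1 / c := by
  have h1 : c * s ≤ Real.exp (c * s) := by linarith [Real.add_one_le_exp (c * s)]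
  have hprod : Real.exp (c * s) * Real.exp (-(c * s)) = 1 := by rw [← Real.exp_add, add_neg_cancel, Real.exp_zero]
  have hpos := Real.exp_pos (-(c * s))
  rw [le_div_iff₀ hc]
  nlinarith

/-- the elementary step `a·S ≤ b·√S·√F`, `a > 0`, `b ≥ 0` ⇒ `S ≤ (b/a)²·F` (`S, F ≥ 0`). [folklore] -/
private theorem le_sq_div_mul_of_mul_le_sqrt {a b S F : ℝ} (ha : 0 < a) (hS : 0 ≤ S) (hF : 0 ≤ F)
    (h : a * S ≤ b * Real.sqrt S * Real.sqrt F) : S ≤ (b / a) ^ 2 * F := by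
  have hsS := Real.sqrt_nonneg S
  have hsF := Real.sqrt_nonneg F
  have h1 : a * Real.sqrt S * Real.sqrt S ≤ b * Real.sqrt F * Real.sqrt S := by
    have e : Real.sqrt S * Real.sqrt S = S := Real.mul_self_sqrt hS
    nlinarith
  rcases eq_or_lt_of_le hsS with h0 | hpos
  · have : S = 0 := by
      have := Real.sqrt_eq_zero'.mp h0.symm
      linarith
    rw [this]; positivity
  · have h2 : a * Real.sqrt S ≤ b * Real.sqrt F := le_of_mul_le_mul_right h1 hpos
    have h3 : Real.sqrt S ≤ b / a * Real.sqrt F := by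
      rw [div_mul_eq_mul_div, le_div_iff₀ ha]; linarith
    calc S = Real.sqrt S ^ 2 := (Real.sq_sqrt hS).symm
      _ ≤ (b / a * Real.sqrt F) ^ 2 := pow_le_pow_left₀ hsS h3 2
      _ = (b / a) ^ 2 * F := by rw [mul_pow, Real.sq_sqrt hF]

/-! ## §7 The conjugated `∂P∂*` under the printed kernel bound (1.126) -/

section ConjK

variable (n : ℕ) [NeZero n] (M : Fin d → ℕ) [hM : ∀ μ, NeZero (M μ)]

/-- **`∂P∂*` ON THE MATRIX OF RECORD**: `GradOp·PcT·GradOpᴴ`, the middle term of `B5DeltaA169.DeltaA`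
(`Δ_a = Δ − ∂P∂* + aQ*Q`, (1.69)/(1.73)). [cite: Balaban1984PropagatorsI, (1.69) p.29, (1.70) p.30, (1.120) p.37] -/
def dPd : Matrix (Tor (fine n M) × Fin d) (Tor (fine n M) × Fin d) ℂ :=
  GradOp (fine n M) (n : ℂ) * PcT n M (n : ℂ) * (GradOp (fine n M) (n : ℂ))ᴴ

/-- `Δ_a = Δ − ∂P∂* + a•Q*Q` (definitional). [cite: Balaban1984PropagatorsI, (1.69) p.29, (1.73) p.30] -/
theorem DeltaA_eq (a : ℝ) : DeltaA n M a = Lap n M - dPd n M + (a : ℂ) • (QvAdj n M * QvOp n M) := rfl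

/-- OUR constant for the row sums of the (1.126) majorant: `C·d·e^{2δ′}K_d(δ′)`. [cite: Balaban1984PropagatorsI, (1.126) p.38 (constants ours)] -/
def normK (d : ℕ) (δ' C : ℝ) : ℝ := C * d * Real.exp (2 * δ') * latticeConst d δ'

/-- OUR constant for the conjugated `∂P∂*`: `C·(4/δ′)·d·e^{δ′/2}K_d(δ′/4)`. [cite: Balaban1984PropagatorsI, (1.126) p.38 (constants ours)] -/
def cK (d : ℕ) (δ' C : ℝ) : ℝ := C * (4 / δ') * d * Real.exp (2 * (δ' / 4)) * latticeConst d (δ' / 4)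

omit [NeZero n] hM in
/-- `0 ≤ normK`. [cite: Balaban1984PropagatorsI, (1.126) p.38 (constants ours)] -/
theorem normK_nonneg {δ' C : ℝ} (hδ' : 0 < δ') (hC : 0 ≤ C) : 0 ≤ normK d δ' C := by
  unfold normK; have := latticeConst_nonneg d hδ'.le; positivity

omit [NeZero n] hM in
/-- `0 ≤ cK`. [cite: Balaban1984PropagatorsI, (1.126) p.38 (constants ours)] -/
theorem cK_nonneg {δ' C : ℝ} (hδ' : 0 < δ') (hC : 0 ≤ C) : 0 ≤ cK d δ' C := by
  unfold cK; have := latticeConst_nonneg d (show 0 ≤ δ' / 4 by positivity); positivity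

/-- row sums of a kernel majorant `C η^d e^{−κ|x_i−x_j|}` over all bonds `j`: `≤ C·d·e^{2κ}K_d(κ)`.
[cite: Balaban1984PropagatorsI, (1.126) p.38 with (1.120) p.37; proof ours] -/
theorem majorant_rowsum_le (hn : 1 ≤ n) {κ C : ℝ} (hκ : 0 < κ) (hC : 0 ≤ C) (x : Tor (fine n M)) :
    ∑ j : Tor (fine n M) × Fin d, C * ((n : ℝ) ^ d)⁻¹ * Real.exp (-(κ * distU n M x j.1))
      ≤ C * d * Real.exp (2 * κ) * latticeConst d κ := by
  rw [Fintype.sum_prod_type]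
  simp only [Finset.sum_const, Finset.card_univ, Fintype.card_fin, nsmul_eq_mul]
  have h := fineRowSum_le n M hn hκ x
  calc ∑ x' : Tor (fine n M), (d : ℝ) * (C * ((n : ℝ) ^ d)⁻¹ * Real.exp (-(κ * distU n M x x')))
      = C * d * ∑ x' : Tor (fine n M), ((n : ℝ) ^ d)⁻¹ * Real.exp (-(κ * distU n M x x')) := by
        rw [Finset.mul_sum]; refine Finset.sum_congr rfl fun x' _ => ?_; ring
    _ ≤ C * d * (Real.exp (2 * κ) * latticeConst d κ) := mul_le_mul_of_nonneg_left h (by positivity)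
    _ = C * d * Real.exp (2 * κ) * latticeConst d κ := by ring

/-- UNDER (1.126): row sums `Σ_j ‖(∂P∂*)(i,j)‖ ≤ normK`. [cite: Balaban1984PropagatorsI, (1.126) p.38] -/
theorem dPd_rowsum_le (hn : 1 ≤ n) {δ' C : ℝ} (hδ' : 0 < δ') (hC : 0 ≤ C)
    (h126 : ∀ i j, ‖dPd n M i j‖ ≤ C * ((n : ℝ) ^ d)⁻¹ * Real.exp (-(δ' * distU n M i.1 j.1)))
    (i : Tor (fine n M) × Fin d) : ∑ j, ‖dPd n M i j‖ ≤ normK d δ' C :=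
  (Finset.sum_le_sum fun j _ => h126 i j).trans (majorant_rowsum_le n M hn hδ' hC i.1)

/-- UNDER (1.126): column sums `Σ_i ‖(∂P∂*)(i,j)‖ ≤ normK`. [cite: Balaban1984PropagatorsI, (1.126) p.38] -/
theorem dPd_colsum_le (hn : 1 ≤ n) {δ' C : ℝ} (hδ' : 0 < δ') (hC : 0 ≤ C)
    (h126 : ∀ i j, ‖dPd n M i j‖ ≤ C * ((n : ℝ) ^ d)⁻¹ * Real.exp (-(δ' * distU n M i.1 j.1)))
    (j : Tor (fine n M) × Fin d) : ∑ i, ‖dPd n M i j‖ ≤ normK d δ' C := by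
  have h : ∀ i, ‖dPd n M i j‖ ≤ C * ((n : ℝ) ^ d)⁻¹ * Real.exp (-(δ' * distU n M j.1 i.1)) := by
    intro i; rw [distU_comm]; exact h126 i j
  exact (Finset.sum_le_sum fun i _ => h i).trans (majorant_rowsum_le n M hn hδ' hC j.1)

/-- UNDER (1.126): `‖∂P∂*‖ ≤ normK` in the form `|⟨u, ∂P∂*w⟩| ≤ normK·‖u‖‖w‖` — «∂P∂*» is a bounded operator on `L²(T_η)`
uniformly in `η` and the torus. [cite: Balaban1984PropagatorsI, (1.126) p.38; proof ours (Schur's test)] -/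
theorem dPd_form_le (hn : 1 ≤ n) {δ' C : ℝ} (hδ' : 0 < δ') (hC : 0 ≤ C)
    (h126 : ∀ i j, ‖dPd n M i j‖ ≤ C * ((n : ℝ) ^ d)⁻¹ * Real.exp (-(δ' * distU n M i.1 j.1)))
    (u w : Tor (fine n M) × Fin d → ℂ) :
    ‖star u ⬝ᵥ (dPd n M *ᵥ w)‖ ≤ normK d δ' C * Real.sqrt (nsq u) * Real.sqrt (nsq w) :=
  norm_form_le_of_schur' n M _ (normK_nonneg (d := d) hδ' hC) (dPd_rowsum_le n M hn hδ' hC h126)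
    (dPd_colsum_le n M hn hδ' hC h126) u w

/-- UNDER (1.126): `‖∂P∂*w‖² ≤ normK²‖w‖²`. [cite: Balaban1984PropagatorsI, (1.126) p.38; proof ours (Schur's test)] -/
theorem nsq_dPd_mulVec_le (hn : 1 ≤ n) {δ' C : ℝ} (hδ' : 0 < δ') (hC : 0 ≤ C)
    (h126 : ∀ i j, ‖dPd n M i j‖ ≤ C * ((n : ℝ) ^ d)⁻¹ * Real.exp (-(δ' * distU n M i.1 j.1)))
    (w : Tor (fine n M) × Fin d → ℂ) : nsq (dPd n M *ᵥ w) ≤ normK d δ' C ^ 2 * nsq w := by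
  have h := Literature.Analysis.Matrix.sum_norm_sq_mulVec_le_of_rowSum_le_of_colSum_le (dPd n M)
    (normK_nonneg (d := d) hδ' hC) (dPd_rowsum_le n M hn hδ' hC h126) (dPd_colsum_le n M hn hδ' hC h126) w
  unfold nsq; rw [sq]; exact h

/-- the entries of the conjugation perturbation of `∂P∂*`: for `|δ| ≤ δ′/2`,
`‖(E ∂P∂* E⁻¹ − ∂P∂*)(i,j)‖ ≤ |δ|·C(4/δ′)·η^d·e^{−(δ′/4)|x_i−x_j|}`. [cite: Balaban1984PropagatorsI, p.36 («small perturbation»), (1.126) p.38; proof ours] -/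
theorem norm_pertW_dPd_le {ρ : Tor (fine n M) → ℝ} (hρ : ∀ x x', |ρ x - ρ x'| ≤ distU n M x x') {δ δ' C : ℝ}
    (hδ' : 0 < δ') (hC : 0 ≤ C) (hδ : |δ| ≤ δ' / 2)
    (h126 : ∀ i j, ‖dPd n M i j‖ ≤ C * ((n : ℝ) ^ d)⁻¹ * Real.exp (-(δ' * distU n M i.1 j.1)))
    (i j : Tor (fine n M) × Fin d) :
    ‖pertW n M δ ρ (dPd n M) i j‖
      ≤ |δ| * (C * (4 / δ')) * ((n : ℝ) ^ d)⁻¹ * Real.exp (-(δ' / 4 * distU n M i.1 j.1)) := by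
  have hs0 : 0 ≤ distU n M i.1 j.1 := distU_nonneg _ _
  have h126' := h126 i j
  refine (norm_pertW_le n M hρ δ _ i j).trans ?_
  generalize distU n M i.1 j.1 = s at hs0 h126' ⊢
  have h1 : Real.exp (|δ| * s) - 1 ≤ |δ| * s * Real.exp (|δ| * s) := exp_sub_one_le_mul_exp _
  have hn0 : 0 ≤ ((n : ℝ) ^ d)⁻¹ := by positivity
  have h2 : ‖dPd n M i j‖ * (Real.exp (|δ| * s) - 1)
      ≤ (C * ((n : ℝ) ^ d)⁻¹ * Real.exp (-(δ' * s))) * (|δ| * s * Real.exp (|δ| * s)) :=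
    mul_le_mul h126' h1 (by linarith [Real.add_one_le_exp (|δ| * s), mul_nonneg (abs_nonneg δ) hs0])
      (by positivity)
  refine h2.trans ?_
  have h3 : Real.exp (-(δ' * s)) * Real.exp (|δ| * s) ≤ Real.exp (-(δ' / 2 * s)) := by
    rw [← Real.exp_add]; apply Real.exp_le_exp.mpr; nlinarith
  have h4 : s * Real.exp (-(δ' / 4 * s)) ≤ 1 / (δ' / 4) := mul_exp_neg_le (by positivity) s
  have h5 : Real.exp (-(δ' / 2 * s)) = Real.exp (-(δ' / 4 * s)) * Real.exp (-(δ' / 4 * s)) := by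
    rw [← Real.exp_add]; ring_nf
  have hE := Real.exp_pos (-(δ' / 4 * s))
  calc C * ((n : ℝ) ^ d)⁻¹ * Real.exp (-(δ' * s)) * (|δ| * s * Real.exp (|δ| * s))
      = C * ((n : ℝ) ^ d)⁻¹ * |δ| * s * (Real.exp (-(δ' * s)) * Real.exp (|δ| * s)) := by ring
    _ ≤ C * ((n : ℝ) ^ d)⁻¹ * |δ| * s * Real.exp (-(δ' / 2 * s)) :=
        mul_le_mul_of_nonneg_left h3 (by positivity)
    _ = C * ((n : ℝ) ^ d)⁻¹ * |δ| * (s * Real.exp (-(δ' / 4 * s))) * Real.exp (-(δ' / 4 * s)) := by rw [h5]; ring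
    _ ≤ C * ((n : ℝ) ^ d)⁻¹ * |δ| * (1 / (δ' / 4)) * Real.exp (-(δ' / 4 * s)) :=
        mul_le_mul_of_nonneg_right (mul_le_mul_of_nonneg_left h4 (by positivity)) hE.le
    _ = |δ| * (C * (4 / δ')) * ((n : ℝ) ^ d)⁻¹ * Real.exp (-(δ' / 4 * s)) := by
        field_simp

/-- UNDER (1.126): row sums of the conjugation perturbation `≤ |δ|·cK`. [cite: Balaban1984PropagatorsI, (1.126) p.38; proof ours] -/
theorem pertW_dPd_rowsum_le (hn : 1 ≤ n) {ρ : Tor (fine n M) → ℝ} (hρ : ∀ x x', |ρ x - ρ x'| ≤ distU n M x x')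
    {δ δ' C : ℝ} (hδ' : 0 < δ') (hC : 0 ≤ C) (hδ : |δ| ≤ δ' / 2)
    (h126 : ∀ i j, ‖dPd n M i j‖ ≤ C * ((n : ℝ) ^ d)⁻¹ * Real.exp (-(δ' * distU n M i.1 j.1)))
    (i : Tor (fine n M) × Fin d) : ∑ j, ‖pertW n M δ ρ (dPd n M) i j‖ ≤ |δ| * cK d δ' C := by
  have hκ : 0 < δ' / 4 := by positivity
  have hC' : 0 ≤ |δ| * (C * (4 / δ')) := by positivity
  refine (Finset.sum_le_sum fun j _ => norm_pertW_dPd_le n M hρ hδ' hC hδ h126 i j).trans ?_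
  refine (majorant_rowsum_le n M hn hκ hC' i.1).trans (le_of_eq ?_)
  unfold cK; ring

/-- UNDER (1.126): column sums of the conjugation perturbation `≤ |δ|·cK`. [cite: Balaban1984PropagatorsI, (1.126) p.38; proof ours] -/
theorem pertW_dPd_colsum_le (hn : 1 ≤ n) {ρ : Tor (fine n M) → ℝ} (hρ : ∀ x x', |ρ x - ρ x'| ≤ distU n M x x')
    {δ δ' C : ℝ} (hδ' : 0 < δ') (hC : 0 ≤ C) (hδ : |δ| ≤ δ' / 2)
    (h126 : ∀ i j, ‖dPd n M i j‖ ≤ C * ((n : ℝ) ^ d)⁻¹ * Real.exp (-(δ' * distU n M i.1 j.1)))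
    (j : Tor (fine n M) × Fin d) : ∑ i, ‖pertW n M δ ρ (dPd n M) i j‖ ≤ |δ| * cK d δ' C := by
  have hκ : 0 < δ' / 4 := by positivity
  have hC' : 0 ≤ |δ| * (C * (4 / δ')) := by positivity
  have h : ∀ i, ‖pertW n M δ ρ (dPd n M) i j‖
      ≤ |δ| * (C * (4 / δ')) * ((n : ℝ) ^ d)⁻¹ * Real.exp (-(δ' / 4 * distU n M j.1 i.1)) := by
    intro i; rw [distU_comm]; exact norm_pertW_dPd_le n M hρ hδ' hC hδ h126 i j
  refine (Finset.sum_le_sum fun i _ => h i).trans ?_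
  refine (majorant_rowsum_le n M hn hκ hC' j.1).trans (le_of_eq ?_)
  unfold cK; ring

/-- **CONJUGATED `∂P∂*`** (UNDER (1.126)): `|⟨Ew, ∂P∂*(E⁻¹w)⟩ − ⟨w, ∂P∂*w⟩| ≤ |δ|·cK·‖w‖²` for `|δ| ≤ δ′/2`.
[cite: Balaban1984PropagatorsI, p.36 («small perturbation of Δ_a»), (1.126) p.38; proof ours (Schur's test)] -/
theorem conjDPD_sub_le (hn : 1 ≤ n) {ρ : Tor (fine n M) → ℝ} (hρ : ∀ x x', |ρ x - ρ x'| ≤ distU n M x x')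
    {δ δ' C : ℝ} (hδ' : 0 < δ') (hC : 0 ≤ C) (hδ : |δ| ≤ δ' / 2)
    (h126 : ∀ i j, ‖dPd n M i j‖ ≤ C * ((n : ℝ) ^ d)⁻¹ * Real.exp (-(δ' * distU n M i.1 j.1)))
    (w : Tor (fine n M) × Fin d → ℂ) :
    ‖star (wmul n M (wt n M δ ρ) w) ⬝ᵥ (dPd n M *ᵥ wmul n M (wt n M (-δ) ρ) w) - star w ⬝ᵥ (dPd n M *ᵥ w)‖
      ≤ |δ| * cK d δ' C * nsq w := by
  rw [conj_form_eq, add_sub_cancel_left]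
  exact norm_form_le_of_schur n M _ (mul_nonneg (abs_nonneg δ) (cK_nonneg (d := d) hδ' hC))
    (pertW_dPd_rowsum_le n M hn hρ hδ' hC hδ h126) (pertW_dPd_colsum_le n M hn hρ hδ' hC hδ h126) w

end ConjK

/-! ## §8 Coercivity of the conjugated form: «a small perturbation of Δ_a for q sufficiently small» -/

section Coercive

variable (n : ℕ) [NeZero n] (M : Fin d → ℕ) [hM : ∀ μ, NeZero (M μ)]

/-- OUR perturbation constant `Θ = 2d + 4e⁴a + cK`: `Re⟨Ew, Δ_a(E⁻¹w)⟩ ≥ Re⟨w, Δ_aw⟩ − δΘ(Σ‖∇w‖² + ‖w‖²)`.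
[cite: Balaban1984PropagatorsI, p.36 (q sufficiently small; constants ours)] -/
def Theta (d : ℕ) (a δ' C : ℝ) : ℝ := 2 * d + 4 * Real.exp 4 * a + cK d δ' C

omit [NeZero n] hM in
/-- `0 ≤ Θ`. [cite: Balaban1984PropagatorsI, p.36 (constants ours)] -/
theorem Theta_nonneg {a δ' C : ℝ} (ha : 0 ≤ a) (hδ' : 0 < δ') (hC : 0 ≤ C) : 0 ≤ Theta d a δ' C := by
  unfold Theta; have := cK_nonneg (d := d) hδ' hC; positivity

/-- the unperturbed form: `Re⟨w, (Δ + 1)w⟩ = Σ_ν‖∇_νw‖² + ‖w‖²`. [cite: Balaban1984PropagatorsI, (1.90) p.33 (kernel lemma)] -/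
theorem re_form_LapOne (w : Tor (fine n M) × Fin d → ℂ) :
    (star w ⬝ᵥ ((Lap n M + 1) *ᵥ w)).re = ∑ ν, nsq (fdiff (fine n M) (n : ℂ) ν *ᵥ w) + nsq w := by
  rw [Matrix.add_mulVec, Matrix.one_mulVec, dotProduct_add, form_Lap, star_dotProduct_self, Complex.add_re,
    Complex.ofReal_re, Complex.ofReal_re]

/-- the expansion `⟨u, Δ_a v⟩ = ⟨u, Δv⟩ − ⟨u, ∂P∂*v⟩ + a⟨u, Q*Qv⟩`. [cite: Balaban1984PropagatorsI, (1.69) p.29] -/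
theorem form_DeltaA_expand (a : ℝ) (u v : Tor (fine n M) × Fin d → ℂ) :
    star u ⬝ᵥ (DeltaA n M a *ᵥ v)
      = star u ⬝ᵥ (Lap n M *ᵥ v) - star u ⬝ᵥ (dPd n M *ᵥ v) + (a : ℂ) * (star u ⬝ᵥ ((QvAdj n M * QvOp n M) *ᵥ v)) := by
  rw [DeltaA_eq, Matrix.add_mulVec, Matrix.sub_mulVec, Matrix.smul_mulVec, dotProduct_add, dotProduct_sub,
    dotProduct_smul, smul_eq_mul]

/-- **COERCIVITY OF THE CONJUGATED FORM** (the «small perturbation of Δ_a»): for `E = e^{δρ}` with `ρ` 1-Lipschitz in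
units, `0 ≤ δ ≤ min(1, δ′/2)`, (1.90) `B5Prop11Lattice.ineq190_form` and (1.126) on `∂P∂*`, every vector field `v` with
`w = Ev` satisfies `(γ₀ − δΘ)·(Σ_ν‖∇_νw‖² + ‖w‖²) ≤ Re⟨Ew, Δ_a v⟩`.
[cite: Balaban1984PropagatorsI, p.36 («e^{−⟨q,x⟩}Δ_a e^{⟨q,x⟩} − Δ_a is a small perturbation of Δ_a for vectors q ∈ R^d
sufficiently small»), Prop. 1.1 (1.90) p.33, (1.126) p.38; proof ours] -/
theorem conj_coercive (hn : 1 ≤ n) {a : ℝ} (ha : 0 < a) {δ' C : ℝ} (hδ' : 0 < δ') (hC : 0 ≤ C)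
    (h126 : ∀ i j, ‖dPd n M i j‖ ≤ C * ((n : ℝ) ^ d)⁻¹ * Real.exp (-(δ' * distU n M i.1 j.1)))
    {ρ : Tor (fine n M) → ℝ} (hρ : ∀ x x', |ρ x - ρ x'| ≤ distU n M x x')
    {δ : ℝ} (hδ0 : 0 ≤ δ) (hδ1 : δ ≤ 1) (hδ2 : δ ≤ δ' / 2) (v : Tor (fine n M) × Fin d → ℂ) :
    (gammaZero d a - δ * Theta d a δ' C) *
        (∑ ν, nsq (fdiff (fine n M) (n : ℂ) ν *ᵥ wmul n M (wt n M δ ρ) v) + nsq (wmul n M (wt n M δ ρ) v))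
      ≤ (star (wmul n M (wt n M δ ρ) (wmul n M (wt n M δ ρ) v)) ⬝ᵥ (DeltaA n M a *ᵥ v)).re := by
  obtain ⟨w, hw⟩ : ∃ w, w = wmul n M (wt n M δ ρ) v := ⟨_, rfl⟩
  have hv : wmul n M (wt n M (-δ) ρ) w = v := by rw [hw, wmul_neg_wmul]
  rw [← hw, ← hv]
  have habs : |δ| ≤ 1 := by rw [abs_of_nonneg hδ0]; exact hδ1
  have habs2 : |δ| ≤ δ' / 2 := by rw [abs_of_nonneg hδ0]; exact hδ2
  set S := ∑ ν, nsq (fdiff (fine n M) (n : ℂ) ν *ᵥ w) + nsq w with hS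
  have hS0 : 0 ≤ S := add_nonneg (Finset.sum_nonneg fun _ _ => nsq_nonneg _) (nsq_nonneg _)
  have hw0 : 0 ≤ nsq w := nsq_nonneg _
  have hwS : nsq w ≤ S := le_add_of_nonneg_left (Finset.sum_nonneg fun _ _ => nsq_nonneg _)
  -- the three conjugated pieces
  have hLap := conjLap_ge n M hρ habs w
  have hK := conjDPD_sub_le n M hn hρ hδ' hC habs2 h126 w
  have hQ := conjQQ_sub_le n M hρ δ w
  -- the unperturbed form and (1.90)
  have h190 := ineq190_form n hn M a ha w
  rw [re_form_LapOne] at h190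
  have hexpw := form_DeltaA_expand n M a w w
  have hLapw : (star w ⬝ᵥ (Lap n M *ᵥ w)).re = ∑ ν, nsq (fdiff (fine n M) (n : ℂ) ν *ᵥ w) := by
    rw [form_Lap, Complex.ofReal_re]
  -- real parts
  have hre : (star (wmul n M (wt n M δ ρ) w) ⬝ᵥ (DeltaA n M a *ᵥ wmul n M (wt n M (-δ) ρ) w)).re
      = (star (wmul n M (wt n M δ ρ) w) ⬝ᵥ (Lap n M *ᵥ wmul n M (wt n M (-δ) ρ) w)).re
        - (star (wmul n M (wt n M δ ρ) w) ⬝ᵥ (dPd n M *ᵥ wmul n M (wt n M (-δ) ρ) w)).re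
        + a * (star (wmul n M (wt n M δ ρ) w) ⬝ᵥ ((QvAdj n M * QvOp n M) *ᵥ wmul n M (wt n M (-δ) ρ) w)).re := by
    rw [form_DeltaA_expand, Complex.add_re, Complex.sub_re, Complex.re_ofReal_mul]
  have hrew : (star w ⬝ᵥ (DeltaA n M a *ᵥ w)).re
      = ∑ ν, nsq (fdiff (fine n M) (n : ℂ) ν *ᵥ w) - (star w ⬝ᵥ (dPd n M *ᵥ w)).re
        + a * (star w ⬝ᵥ ((QvAdj n M * QvOp n M) *ᵥ w)).re := by
    rw [hexpw, Complex.add_re, Complex.sub_re, Complex.re_ofReal_mul, hLapw]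
  -- bounds from the norms of the differences
  have hK' : (star (wmul n M (wt n M δ ρ) w) ⬝ᵥ (dPd n M *ᵥ wmul n M (wt n M (-δ) ρ) w)).re
      ≤ (star w ⬝ᵥ (dPd n M *ᵥ w)).re + |δ| * cK d δ' C * nsq w := by
    have := (Complex.re_le_norm _).trans hK
    rw [Complex.sub_re] at this
    linarith
  have hQ' : (star w ⬝ᵥ ((QvAdj n M * QvOp n M) *ᵥ w)).re - (Real.exp (4 * |δ|) - 1) * nsq w
      ≤ (star (wmul n M (wt n M δ ρ) w) ⬝ᵥ ((QvAdj n M * QvOp n M) *ᵥ wmul n M (wt n M (-δ) ρ) w)).re := by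
    have : (star w ⬝ᵥ ((QvAdj n M * QvOp n M) *ᵥ w)
        - star (wmul n M (wt n M δ ρ) w) ⬝ᵥ ((QvAdj n M * QvOp n M) *ᵥ wmul n M (wt n M (-δ) ρ) w)).re
        ≤ (Real.exp (4 * |δ|) - 1) * nsq w := by
      refine (Complex.re_le_norm _).trans ?_
      rw [← norm_neg, neg_sub]; exact hQ
    rw [Complex.sub_re] at this
    linarith
  -- numerical bounds on the coefficients for `0 ≤ δ ≤ 1`
  rw [abs_of_nonneg hδ0] at hK' hQ'
  have hexp4 : Real.exp (4 * δ) - 1 ≤ 4 * Real.exp 4 * δ := by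
    have h1 : Real.exp (4 * δ) - 1 ≤ 4 * δ * Real.exp (4 * δ) := exp_sub_one_le_mul_exp _
    have h2 : Real.exp (4 * δ) ≤ Real.exp 4 := Real.exp_le_exp.mpr (by linarith)
    nlinarith [Real.exp_pos (4 * δ)]
  have hcK0 := cK_nonneg (d := d) hδ' hC
  have hsq : δ ^ 2 ≤ δ := by nlinarith
  have hd0 : (0 : ℝ) ≤ d := Nat.cast_nonneg d
  -- assemble
  have key : gammaZero d a * S - (2 * d * δ ^ 2 + δ * cK d δ' C + a * (Real.exp (4 * δ) - 1)) * nsq w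
      ≤ (star (wmul n M (wt n M δ ρ) w) ⬝ᵥ (DeltaA n M a *ᵥ wmul n M (wt n M (-δ) ρ) w)).re := by
    rw [hre]
    have ha' := ha.le
    have := mul_le_mul_of_nonneg_left hQ' ha'
    nlinarith [hLap, hK', h190, hrew, this]
  have hcoef : (2 * d * δ ^ 2 + δ * cK d δ' C + a * (Real.exp (4 * δ) - 1)) * nsq w ≤ δ * Theta d a δ' C * S := by
    have h1 : 2 * d * δ ^ 2 + δ * cK d δ' C + a * (Real.exp (4 * δ) - 1) ≤ δ * Theta d a δ' C := by
      unfold Theta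
      have := mul_le_mul_of_nonneg_left hexp4 ha.le
      nlinarith
    have h2 : 0 ≤ 2 * d * δ ^ 2 + δ * cK d δ' C + a * (Real.exp (4 * δ) - 1) := by
      have : 0 ≤ Real.exp (4 * δ) - 1 := by linarith [Real.add_one_le_exp (4 * δ)]
      positivity
    calc (2 * d * δ ^ 2 + δ * cK d δ' C + a * (Real.exp (4 * δ) - 1)) * nsq w
        ≤ (2 * d * δ ^ 2 + δ * cK d δ' C + a * (Real.exp (4 * δ) - 1)) * S := mul_le_mul_of_nonneg_left hwS h2
      _ ≤ δ * Theta d a δ' C * S := mul_le_mul_of_nonneg_right h1 hS0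
  have : (gammaZero d a - δ * Theta d a δ' C) * S = gammaZero d a * S - δ * Theta d a δ' C * S := by ring
  linarith

/-- OUR admissible exponent: `δ₁ = min(1, δ′/2, γ₀/(2Θ))`. [cite: Balaban1984PropagatorsI, Prop. 1.2 p.35 («There exists a positive
constant δ₀»; value ours)] -/
def delta1 (d : ℕ) (a δ' C : ℝ) : ℝ := min 1 (min (δ' / 2) (gammaZero d a / (2 * Theta d a δ' C)))

omit [NeZero n] hM in
/-- `0 < δ₁`. [cite: Balaban1984PropagatorsI, Prop. 1.2 p.35 (δ₀ > 0; value ours)] -/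
theorem delta1_pos {a δ' C : ℝ} (ha : 0 < a) (hδ' : 0 < δ') (hC : 0 ≤ C) : 0 < delta1 d a δ' C := by
  unfold delta1
  refine lt_min one_pos (lt_min (by positivity) ?_)
  have hΘ : 0 < Theta d a δ' C := by
    unfold Theta; have := cK_nonneg (d := d) hδ' hC; positivity
  exact div_pos (gammaZero_pos d a) (by positivity)

omit [NeZero n] hM in
/-- at `δ ≤ δ₁`: `δ ≤ 1`, `δ ≤ δ′/2` and `γ₀/2 ≤ γ₀ − δΘ`. [cite: Balaban1984PropagatorsI, p.36 (q sufficiently small)] -/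
theorem delta1_spec {a δ' C δ : ℝ} (ha : 0 < a) (hδ' : 0 < δ') (hC : 0 ≤ C) (hδ : δ ≤ delta1 d a δ' C) :
    δ ≤ 1 ∧ δ ≤ δ' / 2 ∧ gammaZero d a / 2 ≤ gammaZero d a - δ * Theta d a δ' C := by
  unfold delta1 at hδ
  have h1 := hδ.trans (min_le_left _ _)
  have h2 := (hδ.trans (min_le_right _ _)).trans (min_le_left _ _)
  have h3 := (hδ.trans (min_le_right _ _)).trans (min_le_right _ _)
  refine ⟨h1, h2, ?_⟩
  have hΘ : 0 < Theta d a δ' C := by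
    unfold Theta; have := cK_nonneg (d := d) hδ' hC; positivity
  have h4 : δ * Theta d a δ' C ≤ gammaZero d a / 2 := by
    have := mul_le_mul_of_nonneg_right h3 hΘ.le
    calc δ * Theta d a δ' C ≤ gammaZero d a / (2 * Theta d a δ' C) * Theta d a δ' C := this
      _ = gammaZero d a / 2 := by field_simp
  have := gammaZero_pos d a
  linarith

end Coercive

/-! ## §9 The weighted solves and the dictionary on the cubes -/

section Solve

variable (n : ℕ) [NeZero n] (M : Fin d → ℕ) [hM : ∀ μ, NeZero (M μ)]

/-- moving the real weight across the scalar product: `⟨Ew, f⟩ = ⟨w, Ef⟩`. [cite: Balaban1984PropagatorsI, p.36 (the weight e^{⟨q,x⟩})] -/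
theorem star_wmul_dotProduct (E : Tor (fine n M) → ℝ) (w f : Tor (fine n M) × Fin d → ℂ) :
    star (wmul n M E w) ⬝ᵥ f = star w ⬝ᵥ wmul n M E f := by
  simp only [dotProduct, Pi.star_apply, wmul_apply, star_mul', Complex.star_def, Complex.conj_ofReal]
  refine Finset.sum_congr rfl fun i _ => ?_
  ring

/-- on the support cube the weight is at most `e^δ`: `supp f ⊂ Δ̃(y₁)` ⇒ `‖e^{δρ_{y₁}}f‖² ≤ e^{2δ}‖f‖²` (`δ ≥ 0`).
[cite: Balaban1984PropagatorsI, Prop. 1.2 p.35 (supp J ⊂ Δ̃(y′))] -/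
theorem nsq_wmul_le_of_supp {δ : ℝ} (hδ : 0 ≤ δ) {y₁ : Tor M} {f : Tor (fine n M) × Fin d → ℂ}
    (hf : ∀ i, f i ≠ 0 → i.1 ∈ cubeT n M y₁) :
    nsq (wmul n M (wt n M δ (rho n M y₁)) f) ≤ Real.exp (2 * δ) * nsq f := by
  unfold nsq
  rw [Finset.mul_sum]
  refine Finset.sum_le_sum fun i _ => ?_
  rw [norm_wmul_wt]
  by_cases h0 : f i = 0
  · simp [h0]
  · have hρ := rho_le_one_of_mem_cubeT n M (hf i h0)
    have hw : wt n M δ (rho n M y₁) i.1 ≤ Real.exp δ := by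
      unfold wt; apply Real.exp_le_exp.mpr; nlinarith
    have hw0 := (wt_pos n M δ (rho n M y₁) i.1).le
    calc (wt n M δ (rho n M y₁) i.1 * ‖f i‖) ^ 2 = wt n M δ (rho n M y₁) i.1 ^ 2 * ‖f i‖ ^ 2 := by ring
      _ ≤ Real.exp δ ^ 2 * ‖f i‖ ^ 2 := by gcongr
      _ = Real.exp (2 * δ) * ‖f i‖ ^ 2 := by rw [← Real.exp_nat_mul]; ring_nf

/-- **THE WEIGHTED SOLVE** (source on `Δ̃(y₁)`): if `Δ_a v = f` with `supp f ⊂ Δ̃(y₁) × dirs`, then for `w = e^{δρ_{y₁}}v`,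
`0 ≤ δ ≤ δ₁`: `Σ_ν‖∇_νw‖² + ‖w‖² ≤ (2e^δ/γ₀)²‖f‖²`.
[cite: Balaban1984PropagatorsI, p.36 («simplest proof»), (1.90) p.33, (1.114) p.36; proof ours] -/
theorem solve_bound (hn : 1 ≤ n) {a : ℝ} (ha : 0 < a) {δ' C : ℝ} (hδ' : 0 < δ') (hC : 0 ≤ C)
    (h126 : ∀ i j, ‖dPd n M i j‖ ≤ C * ((n : ℝ) ^ d)⁻¹ * Real.exp (-(δ' * distU n M i.1 j.1)))
    {δ : ℝ} (hδ0 : 0 ≤ δ) (hδ : δ ≤ delta1 d a δ' C) {y₁ : Tor M} {f v : Tor (fine n M) × Fin d → ℂ}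
    (hf : ∀ i, f i ≠ 0 → i.1 ∈ cubeT n M y₁) (hv : DeltaA n M a *ᵥ v = f) :
    ∑ ν, nsq (fdiff (fine n M) (n : ℂ) ν *ᵥ wmul n M (wt n M δ (rho n M y₁)) v) + nsq (wmul n M (wt n M δ (rho n M y₁)) v)
      ≤ (2 * Real.exp δ / gammaZero d a) ^ 2 * nsq f := by
  obtain ⟨h1, h2, hgap⟩ := delta1_spec (d := d) ha hδ' hC hδ
  have hco := conj_coercive n M hn ha hδ' hC h126 (abs_rho_sub_rho_le n M y₁) hδ0 h1 h2 v
  rw [hv] at hco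
  set w := wmul n M (wt n M δ (rho n M y₁)) v with hw
  set S := ∑ ν, nsq (fdiff (fine n M) (n : ℂ) ν *ᵥ w) + nsq w with hS
  have hS0 : 0 ≤ S := add_nonneg (Finset.sum_nonneg fun _ _ => nsq_nonneg _) (nsq_nonneg _)
  have hwS : nsq w ≤ S := le_add_of_nonneg_left (Finset.sum_nonneg fun _ _ => nsq_nonneg _)
  have hγ := gammaZero_pos d a
  -- the right-hand side
  have hrhs : (star (wmul n M (wt n M δ (rho n M y₁)) w) ⬝ᵥ f).re ≤ Real.exp δ * Real.sqrt S * Real.sqrt (nsq f) := by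
    refine (Complex.re_le_norm _).trans ?_
    rw [star_wmul_dotProduct]
    refine (B5Prop11Lower.norm_star_dotProduct_le w _).trans ?_
    have h3 : Real.sqrt (nsq (wmul n M (wt n M δ (rho n M y₁)) f)) ≤ Real.exp δ * Real.sqrt (nsq f) := by
      calc Real.sqrt (nsq (wmul n M (wt n M δ (rho n M y₁)) f)) ≤ Real.sqrt (Real.exp (2 * δ) * nsq f) :=
            Real.sqrt_le_sqrt (nsq_wmul_le_of_supp n M hδ0 hf)
        _ = Real.exp δ * Real.sqrt (nsq f) := by
            rw [Real.sqrt_mul (Real.exp_pos _).le, show (2 : ℝ) * δ = δ + δ by ring, Real.exp_add,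
              Real.sqrt_mul_self (Real.exp_pos δ).le]
    have h4 : Real.sqrt (nsq w) ≤ Real.sqrt S := Real.sqrt_le_sqrt hwS
    calc Real.sqrt (nsq w) * Real.sqrt (nsq (wmul n M (wt n M δ (rho n M y₁)) f))
        ≤ Real.sqrt S * (Real.exp δ * Real.sqrt (nsq f)) :=
          mul_le_mul h4 h3 (Real.sqrt_nonneg _) (Real.sqrt_nonneg _)
      _ = Real.exp δ * Real.sqrt S * Real.sqrt (nsq f) := by ring
  have hmain : gammaZero d a / 2 * S ≤ Real.exp δ * Real.sqrt S * Real.sqrt (nsq f) := by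
    have := mul_le_mul_of_nonneg_right hgap hS0
    linarith
  have h := le_sq_div_mul_of_mul_le_sqrt (by positivity) hS0 (nsq_nonneg f) hmain
  calc S ≤ (Real.exp δ / (gammaZero d a / 2)) ^ 2 * nsq f := h
    _ = (2 * Real.exp δ / gammaZero d a) ^ 2 * nsq f := by
        congr 1; field_simp

/-- the product rule bound: `|∇_ν(E u)(i)| ≤ E(i⁺)|∇_νu(i)| + 2|δ|E(i)|u(i)|`, `E = e^{δρ}`, `|δ| ≤ 1`.
[cite: Balaban1984PropagatorsI, (1.120)–(1.121) p.37 (commutator with a multiplication operator); proof ours] -/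
theorem norm_fdiff_wmul_le {ρ : Tor (fine n M) → ℝ} (hρ : ∀ x x', |ρ x - ρ x'| ≤ distU n M x x') {δ : ℝ} (hδ : |δ| ≤ 1)
    (u : Tor (fine n M) × Fin d → ℂ) (ν : Fin d) (i : Tor (fine n M) × Fin d) :
    ‖(fdiff (fine n M) (n : ℂ) ν *ᵥ wmul n M (wt n M δ ρ) u) i‖
      ≤ wt n M δ ρ (nb n M ν i).1 * ‖(fdiff (fine n M) (n : ℂ) ν *ᵥ u) i‖ + 2 * |δ| * wt n M δ ρ i.1 * ‖u i‖ := by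
  rw [fdiff_wmul]
  refine (norm_add_le _ _).trans ?_
  rw [norm_mul, norm_mul, Complex.norm_real, Complex.norm_real, Real.norm_of_nonneg (wt_pos n M δ ρ _).le,
    Real.norm_eq_abs, abs_mul, Nat.abs_cast]
  have h := mul_abs_wt_sub_le n M hρ hδ i.1 ν
  have : (n : ℝ) * |wt n M δ ρ (nb n M ν i).1 - wt n M δ ρ i.1| * ‖u i‖ ≤ 2 * |δ| * wt n M δ ρ i.1 * ‖u i‖ :=
    mul_le_mul_of_nonneg_right h (norm_nonneg _)
  unfold nb at this ⊢
  linarith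

/-- **THE WEIGHTED SOLVE FOR A DIVERGENCE SOURCE** (`G∇*`): if `Δ_a v = ∇*T = Σ_ν ∇_ν^* T_ν` with every `T_ν` supported on
`Δ̃(y₁) × dirs`, then for `w = e^{δρ_{y₁}}v`, `0 ≤ δ ≤ δ₁`: `Σ_ν‖∇_νw‖² + ‖w‖² ≤ 72(d+1)e^{2δ}/γ₀² · Σ_ν‖T_ν‖²`.
[cite: Balaban1984PropagatorsI, p.36 («simplest proof»), (1.90) p.33, (1.114) p.36 (ζG∇*J, ζ∇G∇*J); proof ours] -/
theorem solveDiv_bound (hn : 1 ≤ n) {a : ℝ} (ha : 0 < a) {δ' C : ℝ} (hδ' : 0 < δ') (hC : 0 ≤ C)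
    (h126 : ∀ i j, ‖dPd n M i j‖ ≤ C * ((n : ℝ) ^ d)⁻¹ * Real.exp (-(δ' * distU n M i.1 j.1)))
    {δ : ℝ} (hδ0 : 0 ≤ δ) (hδ : δ ≤ delta1 d a δ' C) {y₁ : Tor M} {T : Fin d → Tor (fine n M) × Fin d → ℂ}
    {v : Tor (fine n M) × Fin d → ℂ} (hT : ∀ ν i, T ν i ≠ 0 → i.1 ∈ cubeT n M y₁)
    (hv : DeltaA n M a *ᵥ v = ∑ ν, (fdiff (fine n M) (n : ℂ) ν)ᴴ *ᵥ T ν) :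
    ∑ ν, nsq (fdiff (fine n M) (n : ℂ) ν *ᵥ wmul n M (wt n M δ (rho n M y₁)) v) + nsq (wmul n M (wt n M δ (rho n M y₁)) v)
      ≤ 72 * (d + 1) * Real.exp (2 * δ) / gammaZero d a ^ 2 * ∑ ν, nsq (T ν) := by
  obtain ⟨h1, h2, hgap⟩ := delta1_spec (d := d) ha hδ' hC hδ
  have habs : |δ| ≤ 1 := by rw [abs_of_nonneg hδ0]; exact h1
  have hρL := abs_rho_sub_rho_le n M y₁
  have hco := conj_coercive n M hn ha hδ' hC h126 hρL hδ0 h1 h2 v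
  rw [hv] at hco
  set E := wt n M δ (rho n M y₁) with hE
  set w := wmul n M E v with hw
  set S := ∑ ν, nsq (fdiff (fine n M) (n : ℂ) ν *ᵥ w) + nsq w with hS
  have hS0 : 0 ≤ S := add_nonneg (Finset.sum_nonneg fun _ _ => nsq_nonneg _) (nsq_nonneg _)
  have hγ := gammaZero_pos d a
  have hd1 : (0 : ℝ) < d + 1 := by positivity
  -- pointwise bound on the support: |∇_ν(Ew)(i)| ≤ 3e^δ(|∇_νw(i)| + |w(i)|) for i over Δ̃(y₁)
  have hpt : ∀ ν i, i.1 ∈ cubeT n M y₁ →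
      ‖(fdiff (fine n M) (n : ℂ) ν *ᵥ wmul n M E w) i‖
        ≤ 3 * Real.exp δ * (‖(fdiff (fine n M) (n : ℂ) ν *ᵥ w) i‖ + ‖w i‖) := by
    intro ν i hi
    refine (norm_fdiff_wmul_le n M hρL habs w ν i).trans ?_
    have hEi : E i.1 ≤ Real.exp δ := by
      rw [hE]; unfold wt; apply Real.exp_le_exp.mpr
      have := rho_le_one_of_mem_cubeT n M hi; nlinarith
    have hEn : E (nb n M ν i).1 ≤ 3 * Real.exp δ := (wt_nb_le n M hρL habs i.1 ν).trans (by linarith)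
    have hE0 := (wt_pos n M δ (rho n M y₁) i.1).le
    have hA := norm_nonneg ((fdiff (fine n M) (n : ℂ) ν *ᵥ w) i)
    have hB := norm_nonneg (w i)
    have hex := (Real.exp_pos δ).le
    calc E (nb n M ν i).1 * ‖(fdiff (fine n M) (n : ℂ) ν *ᵥ w) i‖ + 2 * |δ| * E i.1 * ‖w i‖
        ≤ 3 * Real.exp δ * ‖(fdiff (fine n M) (n : ℂ) ν *ᵥ w) i‖ + 2 * 1 * Real.exp δ * ‖w i‖ := by
          gcongr
      _ ≤ 3 * Real.exp δ * (‖(fdiff (fine n M) (n : ℂ) ν *ᵥ w) i‖ + ‖w i‖) := by nlinarith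
  -- each direction: |⟨∇_ν(Ew), T_ν⟩| ≤ 3e^δ √(2(‖∇_νw‖² + ‖w‖²)) √‖T_ν‖²
  have hdir : ∀ ν, ‖star (fdiff (fine n M) (n : ℂ) ν *ᵥ wmul n M E w) ⬝ᵥ T ν‖
      ≤ 3 * Real.exp δ * Real.sqrt (2 * (nsq (fdiff (fine n M) (n : ℂ) ν *ᵥ w) + nsq w)) * Real.sqrt (nsq (T ν)) := by
    intro ν
    set A := fdiff (fine n M) (n : ℂ) ν *ᵥ wmul n M E w with hA
    set A' : Tor (fine n M) × Fin d → ℂ := fun i => if i.1 ∈ cubeT n M y₁ then A i else 0 with hA'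
    have heq : star A ⬝ᵥ T ν = star A' ⬝ᵥ T ν := by
      simp only [dotProduct, Pi.star_apply, hA']
      refine Finset.sum_congr rfl fun i _ => ?_
      by_cases hi : i.1 ∈ cubeT n M y₁
      · rw [if_pos hi]
      · have : T ν i = 0 := by by_contra h0; exact hi (hT ν i h0)
        rw [this, mul_zero, mul_zero]
    rw [heq]
    refine (B5Prop11Lower.norm_star_dotProduct_le A' (T ν)).trans ?_
    refine mul_le_mul_of_nonneg_right ?_ (Real.sqrt_nonneg _)
    have hA'2 : nsq A' ≤ (3 * Real.exp δ) ^ 2 * (2 * (nsq (fdiff (fine n M) (n : ℂ) ν *ᵥ w) + nsq w)) := by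
      unfold nsq
      have hre : (3 * Real.exp δ) ^ 2 * (2 * (∑ i, ‖(fdiff (fine n M) (n : ℂ) ν *ᵥ w) i‖ ^ 2 + ∑ i, ‖w i‖ ^ 2))
          = ∑ i, (3 * Real.exp δ) ^ 2 * (2 * ‖(fdiff (fine n M) (n : ℂ) ν *ᵥ w) i‖ ^ 2 + 2 * ‖w i‖ ^ 2) := by
        rw [← Finset.mul_sum, Finset.sum_add_distrib, ← Finset.mul_sum, ← Finset.mul_sum]; ring
      rw [hre]
      refine Finset.sum_le_sum fun i _ => ?_
      by_cases hi : i.1 ∈ cubeT n M y₁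
      · have hAi : A' i = A i := by simp only [hA', if_pos hi]
        rw [hAi]
        have h := hpt ν i hi
        have h0 := norm_nonneg (A i)
        calc ‖A i‖ ^ 2 ≤ (3 * Real.exp δ * (‖(fdiff (fine n M) (n : ℂ) ν *ᵥ w) i‖ + ‖w i‖)) ^ 2 :=
              pow_le_pow_left₀ h0 h 2
          _ ≤ (3 * Real.exp δ) ^ 2 * (2 * ‖(fdiff (fine n M) (n : ℂ) ν *ᵥ w) i‖ ^ 2 + 2 * ‖w i‖ ^ 2) := by
              nlinarith [sq_nonneg (‖(fdiff (fine n M) (n : ℂ) ν *ᵥ w) i‖ - ‖w i‖), Real.exp_pos δ]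
          _ = _ := by ring
      · have hAi : A' i = 0 := by simp only [hA', if_neg hi]
        rw [hAi, norm_zero, sq, zero_mul]
        positivity
    calc Real.sqrt (nsq A') ≤ Real.sqrt ((3 * Real.exp δ) ^ 2 * (2 * (nsq (fdiff (fine n M) (n : ℂ) ν *ᵥ w) + nsq w))) :=
          Real.sqrt_le_sqrt hA'2
      _ = 3 * Real.exp δ * Real.sqrt (2 * (nsq (fdiff (fine n M) (n : ℂ) ν *ᵥ w) + nsq w)) := by
          rw [Real.sqrt_mul (sq_nonneg _), Real.sqrt_sq (by positivity)]
  -- sum over directions by Cauchy–Schwarz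
  have hrhs : (star (wmul n M E w) ⬝ᵥ ∑ ν, (fdiff (fine n M) (n : ℂ) ν)ᴴ *ᵥ T ν).re
      ≤ 3 * Real.exp δ * Real.sqrt (2 * (d + 1) * S) * Real.sqrt (∑ ν, nsq (T ν)) := by
    refine (Complex.re_le_norm _).trans ?_
    rw [dotProduct_sum]
    refine (norm_sum_le _ _).trans ?_
    have h3 : ∀ ν, ‖star (wmul n M E w) ⬝ᵥ ((fdiff (fine n M) (n : ℂ) ν)ᴴ *ᵥ T ν)‖
        ≤ 3 * Real.exp δ * (Real.sqrt (2 * (nsq (fdiff (fine n M) (n : ℂ) ν *ᵥ w) + nsq w)) * Real.sqrt (nsq (T ν))) := by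
      intro ν; rw [star_dotProduct_conjTranspose_mulVec, ← mul_assoc]; exact hdir ν
    refine (Finset.sum_le_sum fun ν _ => h3 ν).trans ?_
    rw [← Finset.mul_sum Finset.univ (fun ν => Real.sqrt (2 * (nsq (fdiff (fine n M) (n : ℂ) ν *ᵥ w) + nsq w))
      * Real.sqrt (nsq (T ν))) (3 * Real.exp δ)]
    have hcs := Real.sum_sqrt_mul_sqrt_le (s := (Finset.univ : Finset (Fin d)))
      (f := fun ν : Fin d => 2 * (nsq (fdiff (fine n M) (n : ℂ) ν *ᵥ w) + nsq w)) (g := fun ν : Fin d => nsq (T ν))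
      (fun ν => by have := nsq_nonneg (fdiff (fine n M) (n : ℂ) ν *ᵥ w); have := nsq_nonneg w; positivity)
      (fun ν => nsq_nonneg _)
    have hsum : Real.sqrt (∑ ν, 2 * (nsq (fdiff (fine n M) (n : ℂ) ν *ᵥ w) + nsq w)) ≤ Real.sqrt (2 * (d + 1) * S) := by
      refine Real.sqrt_le_sqrt ?_
      have hw0 := nsq_nonneg w
      have hsum0 := Finset.sum_nonneg fun ν (_ : ν ∈ Finset.univ) => nsq_nonneg (fdiff (fine n M) (n : ℂ) ν *ᵥ w)
      have hwS : nsq w ≤ S := by rw [hS]; linarith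
      have e3 : 2 * S = ∑ ν, 2 * nsq (fdiff (fine n M) (n : ℂ) ν *ᵥ w) + 2 * nsq w := by
        rw [hS, mul_add, Finset.mul_sum]
      have e4 : ∑ ν, 2 * (nsq (fdiff (fine n M) (n : ℂ) ν *ᵥ w) + nsq w)
          = (∑ ν, 2 * nsq (fdiff (fine n M) (n : ℂ) ν *ᵥ w)) + 2 * d * nsq w := by
        simp only [mul_add, Finset.sum_add_distrib, Finset.sum_const, Finset.card_univ, Fintype.card_fin, nsmul_eq_mul]
        ring
      rw [e4]
      have hd0 : (0 : ℝ) ≤ d := Nat.cast_nonneg d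
      nlinarith
    have hex : (0 : ℝ) ≤ 3 * Real.exp δ := by positivity
    calc 3 * Real.exp δ * ∑ ν, Real.sqrt (2 * (nsq (fdiff (fine n M) (n : ℂ) ν *ᵥ w) + nsq w)) * Real.sqrt (nsq (T ν))
        ≤ 3 * Real.exp δ * (Real.sqrt (∑ ν, 2 * (nsq (fdiff (fine n M) (n : ℂ) ν *ᵥ w) + nsq w))
            * Real.sqrt (∑ ν, nsq (T ν))) := mul_le_mul_of_nonneg_left hcs hex
      _ ≤ 3 * Real.exp δ * (Real.sqrt (2 * (d + 1) * S) * Real.sqrt (∑ ν, nsq (T ν))) :=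
          mul_le_mul_of_nonneg_left (mul_le_mul_of_nonneg_right hsum (Real.sqrt_nonneg _)) hex
      _ = 3 * Real.exp δ * Real.sqrt (2 * (d + 1) * S) * Real.sqrt (∑ ν, nsq (T ν)) := by ring
  have hmain : gammaZero d a / 2 * S
      ≤ 3 * Real.exp δ * Real.sqrt (2 * (d + 1)) * Real.sqrt S * Real.sqrt (∑ ν, nsq (T ν)) := by
    have := mul_le_mul_of_nonneg_right hgap hS0
    rw [Real.sqrt_mul (by positivity : (0 : ℝ) ≤ 2 * (d + 1))] at hrhs
    linarith
  have hF := Finset.sum_nonneg fun ν (_ : ν ∈ Finset.univ) => nsq_nonneg (T ν)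
  have h := le_sq_div_mul_of_mul_le_sqrt (by positivity) hS0 hF hmain
  refine h.trans (le_of_eq ?_)
  congr 1
  rw [div_pow, mul_pow, mul_pow, Real.sq_sqrt (by positivity : (0 : ℝ) ≤ 2 * (d + 1)), ← Real.exp_nat_mul]
  field_simp
  ring_nf

/-! ### The dictionary on the cubes (for the entry files) -/

/-- on the observation cube `Δ̃(y)` the inverse weight is small: `e^{−δρ_{y₁}} ≤ e^{2δ}e^{−δ|y−y₁|}` there (`δ ≥ 0`).
[cite: Balaban1984PropagatorsI, Prop. 1.2 (1.114) p.36 (e^{−δ₀|y−y′|}|ζ|)] -/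
theorem wt_neg_le_of_mem_cubeT (hn : 1 ≤ n) {δ : ℝ} (hδ : 0 ≤ δ) {x : Tor (fine n M)} {y : Tor M}
    (hx : x ∈ cubeT n M y) (y₁ : Tor M) :
    wt n M (-δ) (rho n M y₁) x ≤ Real.exp (2 * δ) * Real.exp (-(δ * distSite M y y₁)) := by
  unfold wt
  rw [← Real.exp_add]
  apply Real.exp_le_exp.mpr
  have := distSite_sub_two_le_rho n M hn hx y₁
  nlinarith

/-- … and one fine step further: `e^{−δρ_{y₁}}(x + e_ν) ≤ 3e^{2δ}e^{−δ|y−y₁|}` for `x ∈ Δ̃(y)`, `0 ≤ δ ≤ 1`.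
[cite: Balaban1984PropagatorsI, Prop. 1.2 (1.114) p.36 (e^{−δ₀|y−y′|}|ζ|)] -/
theorem wt_neg_nb_le_of_mem_cubeT (hn : 1 ≤ n) {δ : ℝ} (hδ : 0 ≤ δ) (hδ1 : δ ≤ 1) {x : Tor (fine n M)} {y : Tor M}
    (hx : x ∈ cubeT n M y) (y₁ : Tor M) (ν : Fin d) :
    wt n M (-δ) (rho n M y₁) (x + unitVec (fine n M) ν) ≤ 3 * (Real.exp (2 * δ) * Real.exp (-(δ * distSite M y y₁))) := by
  have habs : |(-δ)| ≤ 1 := by rw [abs_neg, abs_of_nonneg hδ]; exact hδ1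
  refine (wt_nb_le n M (abs_rho_sub_rho_le n M y₁) habs x ν).trans ?_
  exact mul_le_mul_of_nonneg_left (wt_neg_le_of_mem_cubeT n M hn hδ hx y₁) (by norm_num)

/-- on the support cube the weight is at most `e^δ` (`δ ≥ 0`). [cite: Balaban1984PropagatorsI, Prop. 1.2 p.35 (supp J ⊂ Δ̃(y′))] -/
theorem wt_le_of_mem_cubeT {δ : ℝ} (hδ : 0 ≤ δ) {x : Tor (fine n M)} {y₁ : Tor M} (hx : x ∈ cubeT n M y₁) :
    wt n M δ (rho n M y₁) x ≤ Real.exp δ := by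
  unfold wt; apply Real.exp_le_exp.mpr
  have := rho_le_one_of_mem_cubeT n M hx; nlinarith

omit [NeZero n] hM in
/-- unweighting a vector field: `v = e^{−δρ}(e^{δρ}v)` pointwise in norm, `‖v i‖ = e^{−δρ(i)}‖w i‖`.
[cite: Balaban1984PropagatorsI, p.36 (the weight)] -/
theorem norm_eq_wt_neg_mul (δ : ℝ) (ρ : Tor (fine n M) → ℝ) (v : Tor (fine n M) × Fin d → ℂ)
    (i : Tor (fine n M) × Fin d) :
    ‖v i‖ = wt n M (-δ) ρ i.1 * ‖wmul n M (wt n M δ ρ) v i‖ := by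
  rw [norm_wmul_wt, ← mul_assoc, wt_neg, inv_mul_cancel₀ (wt_pos n M δ ρ i.1).ne', one_mul]

end Solve

/-! ## §10 Norms of the conjugated operators `E ∂P∂* E⁻¹`, `E Q*Q E⁻¹` (for the second-order entry) -/

section ConjNorms

variable (n : ℕ) [NeZero n] (M : Fin d → ℕ) [hM : ∀ μ, NeZero (M μ)]

/-- `E X E⁻¹ = X + (EXE⁻¹ − X)` applied to a vector. [cite: Balaban1984PropagatorsI, p.36 (e^{−⟨q,x⟩}Δ_a e^{⟨q,x⟩} − Δ_a)] -/
theorem wmul_mulVec_wmul_neg (δ : ℝ) (ρ : Tor (fine n M) → ℝ)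
    (X : Matrix (Tor (fine n M) × Fin d) (Tor (fine n M) × Fin d) ℂ) (w : Tor (fine n M) × Fin d → ℂ) :
    wmul n M (wt n M δ ρ) (X *ᵥ wmul n M (wt n M (-δ) ρ) w) = X *ᵥ w + pertW n M δ ρ X *ᵥ w := by
  funext i
  rw [Pi.add_apply]
  simp only [wmul_apply, Matrix.mulVec, dotProduct, pertW, Matrix.of_apply, Finset.mul_sum, ← Finset.sum_add_distrib]
  refine Finset.sum_congr rfl fun j _ => ?_
  push_cast
  ring

/-- Schur's test for the `ℓ²` norm: `‖Xw‖ ≤ R‖w‖`. [cite: HornJohnson2013, §5.6 (Schur's test)] -/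
theorem l2_mulVec_le_of_schur (X : Matrix (Tor (fine n M) × Fin d) (Tor (fine n M) × Fin d) ℂ) {R : ℝ} (hR : 0 ≤ R)
    (hrow : ∀ i, ∑ j, ‖X i j‖ ≤ R) (hcol : ∀ j, ∑ i, ‖X i j‖ ≤ R) (w : Tor (fine n M) × Fin d → ℂ) :
    B5Prop11Lattice.l2 (X *ᵥ w) ≤ R * B5Prop11Lattice.l2 w := by
  unfold B5Prop11Lattice.l2
  have h := Literature.Analysis.Matrix.sum_norm_sq_mulVec_le_of_rowSum_le_of_colSum_le X hR hrow hcol w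
  calc Real.sqrt (nsq (X *ᵥ w)) ≤ Real.sqrt (R * R * nsq w) := Real.sqrt_le_sqrt h
    _ = R * Real.sqrt (nsq w) := by rw [Real.sqrt_mul (mul_nonneg hR hR), Real.sqrt_mul_self hR]

/-- UNDER (1.126): `‖E ∂P∂* E⁻¹ w‖ ≤ (normK + |δ|cK)‖w‖` for `|δ| ≤ δ′/2`.
[cite: Balaban1984PropagatorsI, (1.126) p.38, p.36 («small perturbation»); proof ours] -/
theorem l2_conjDPD_le (hn : 1 ≤ n) {ρ : Tor (fine n M) → ℝ} (hρ : ∀ x x', |ρ x - ρ x'| ≤ distU n M x x')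
    {δ δ' C : ℝ} (hδ' : 0 < δ') (hC : 0 ≤ C) (hδ : |δ| ≤ δ' / 2)
    (h126 : ∀ i j, ‖dPd n M i j‖ ≤ C * ((n : ℝ) ^ d)⁻¹ * Real.exp (-(δ' * distU n M i.1 j.1)))
    (w : Tor (fine n M) × Fin d → ℂ) :
    B5Prop11Lattice.l2 (wmul n M (wt n M δ ρ) (dPd n M *ᵥ wmul n M (wt n M (-δ) ρ) w))
      ≤ (normK d δ' C + |δ| * cK d δ' C) * B5Prop11Lattice.l2 w := by
  rw [wmul_mulVec_wmul_neg]
  refine (B5Prop11Lattice.l2_add_le _ _).trans ?_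
  have h1 := l2_mulVec_le_of_schur n M (dPd n M) (normK_nonneg (d := d) hδ' hC) (dPd_rowsum_le n M hn hδ' hC h126)
    (dPd_colsum_le n M hn hδ' hC h126) w
  have h2 := l2_mulVec_le_of_schur n M _ (mul_nonneg (abs_nonneg δ) (cK_nonneg (d := d) hδ' hC))
    (pertW_dPd_rowsum_le n M hn hρ hδ' hC hδ h126) (pertW_dPd_colsum_le n M hn hρ hδ' hC hδ h126) w
  linarith

/-- the entries of the conjugation perturbation of `Q*Q`: `≤ (e^{4|δ|} − 1)‖(Q*Q)(i,j)‖`.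
[cite: Balaban1984PropagatorsI, (1.18) p.20, p.36 («small perturbation»); proof ours] -/
theorem norm_pertW_QQ_le {ρ : Tor (fine n M) → ℝ} (hρ : ∀ x x', |ρ x - ρ x'| ≤ distU n M x x') (δ : ℝ)
    (i j : Tor (fine n M) × Fin d) :
    ‖pertW n M δ ρ (QvAdj n M * QvOp n M) i j‖ ≤ (Real.exp (4 * |δ|) - 1) * ‖(QvAdj n M * QvOp n M) i j‖ := by
  by_cases h0 : (QvAdj n M * QvOp n M) i j = 0
  · simp [pertW, h0]
  · refine (norm_pertW_le n M hρ δ _ i j).trans ?_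
    rw [mul_comm]
    refine mul_le_mul_of_nonneg_right ?_ (norm_nonneg _)
    have h4 := distU_le_four_of_QQ_ne_zero n M h0
    have : |δ| * distU n M i.1 j.1 ≤ 4 * |δ| := by nlinarith [abs_nonneg δ]
    linarith [Real.exp_le_exp.mpr this]

/-- `‖E Q*Q E⁻¹ w‖ ≤ e^{4|δ|}‖w‖`. [cite: Balaban1984PropagatorsI, (1.18) p.20, p.36 («small perturbation»); proof ours] -/
theorem l2_conjQQ_le {ρ : Tor (fine n M) → ℝ} (hρ : ∀ x x', |ρ x - ρ x'| ≤ distU n M x x') (δ : ℝ)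
    (w : Tor (fine n M) × Fin d → ℂ) :
    B5Prop11Lattice.l2 (wmul n M (wt n M δ ρ) ((QvAdj n M * QvOp n M) *ᵥ wmul n M (wt n M (-δ) ρ) w))
      ≤ Real.exp (4 * |δ|) * B5Prop11Lattice.l2 w := by
  rw [wmul_mulVec_wmul_neg]
  refine (B5Prop11Lattice.l2_add_le _ _).trans ?_
  have h1 := l2_mulVec_le_of_schur n M (QvAdj n M * QvOp n M) zero_le_one (fun i => (QQ_rowsum n M i).le)
    (fun j => (QQ_colsum n M j).le) w
  have hR : 0 ≤ Real.exp (4 * |δ|) - 1 := by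
    have : 0 ≤ 4 * |δ| := by positivity
    linarith [Real.add_one_le_exp (4 * |δ|)]
  have hent := norm_pertW_QQ_le n M hρ δ
  have hrow : ∀ i, ∑ j, ‖pertW n M δ ρ (QvAdj n M * QvOp n M) i j‖ ≤ Real.exp (4 * |δ|) - 1 := fun i =>
    calc ∑ j, ‖pertW n M δ ρ (QvAdj n M * QvOp n M) i j‖
        ≤ ∑ j, (Real.exp (4 * |δ|) - 1) * ‖(QvAdj n M * QvOp n M) i j‖ := Finset.sum_le_sum fun j _ => hent i j
      _ = Real.exp (4 * |δ|) - 1 := by rw [← Finset.mul_sum, QQ_rowsum, mul_one]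
  have hcol : ∀ j, ∑ i, ‖pertW n M δ ρ (QvAdj n M * QvOp n M) i j‖ ≤ Real.exp (4 * |δ|) - 1 := fun j =>
    calc ∑ i, ‖pertW n M δ ρ (QvAdj n M * QvOp n M) i j‖
        ≤ ∑ i, (Real.exp (4 * |δ|) - 1) * ‖(QvAdj n M * QvOp n M) i j‖ := Finset.sum_le_sum fun i _ => hent i j
      _ = Real.exp (4 * |δ|) - 1 := by rw [← Finset.mul_sum, QQ_colsum, mul_one]
  have h2 := l2_mulVec_le_of_schur n M _ hR hrow hcol w
  linarith

end ConjNorms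

end

end Literature.MathematicalPhysics.QuantumFieldTheory.Balaban1983to89.B5CombesThomasLatticeSolve
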